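import Summits.NavierStokesRegularity.FluidComputer.PalasekTowerTameCarrierAt
import Literature.Analysis.FluidPDE.SmallL3ClassicalSupBound

/-!
# The TAME CARRIER RUN AT ARBITRARY RATES `R`: the strict slot `LevelZeroDataAt R` holds carriers of
# arbitrarily small `L³` size, and one of them has a FREE Navier–Stokes run under `2Y₀(R)` on the whole first
# window `[1, τ₁(R)]` — layer L3 of the door port (the carrier half of any superposition door at `R`)

Cell `ns-blowup`, seat `ns-blowup-ecbridge-3` (g8); GROUP C «BRIDGE SUPPORT» of the route
`PalasekTowerBreakdown` after the RE-BASE (rev 19; live crux `EpisodeBaseT := EpisodeBaseGAt TowerRates.tuned`,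
stmt-NavierStokesRegularity-20303). The `R`-generic twin of `PalasekTowerGermHostTameCarrier` §4 and
`PalasekTowerGermHostTameCarrierRun` (this lineage, wide). LABEL: E–C typing (KERNEL: theorems only).
WHAT THIS IS NOT: not Navier–Stokes evidence about any crux — an existence-with-sup-bound theorem (Kato small
`L³` data + Leray short time, `Literature.Analysis.FluidPDE.exists_classical_run_norm_le_two_mul_Icc`) for ONE
designed carrier datum at the rates `R`; no mechanism run meeting any letter is exhibited; nothing about
`RungG 1` or blow-up.

* §1 `‖tinyProfileAt R a‖₃ = (Y₀(R)/Y₀(wide)) ‖tinyProfile a‖₃`, `‖tameCarrierAt R a λ‖₃ ≤ …`;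
* §2 **`exists_levelZeroDataAt_small`**: for every `δ > 0` a strict-slot filler at `R` with `‖·‖_{L³} ≤ δ`
  (smooth, compactly supported, divergence free, speed `≤ Y₀(R)`);
* §3 **`exists_levelZeroDataAt_tame_freeRun`**: a strict-slot filler at `R` with a classical finite-energy
  FREE run (`ν = 1`) on `[1, τ₁(R)]` staying `≤ 2Y₀(R)`; **`exists_levelZeroDataAt_tame_freeRun_cap`**: under the
  registered band `2Y₀ ≤ Y₁` it stays `≤ (5/3)Y₁(R) − η` for every margin `η ≤ Y₁(R)/3`;
* §4 the tuned instances.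

References: T. Kato, Math. Z. 187 (1984), Thm. 2–4 [cite: Kato1984, Thm. 2–4]; J. Leray, Acta Math. 63
(1934), §19 (3.8), §21 (3.15) [cite: Leray1934, §19 (3.8) p. 223 and §21 (3.15) p. 226]; S. Palasek,
arXiv:2605.13827 §3.3 [cite: Palasek2026ElementaryModel, §3.3].
-/

noncomputable section

namespace Summit.NavierStokesRegularity.FluidComputer.PalasekTowerClayBridge.Germ

open Set Function Filter Topology Metric MeasureTheory
open scoped Topology ContDiff ENNReal

open Literature.Analysis.FluidPDE TinyBlob

variable {R : TowerRates} {a lam : ℝ}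

/-! ## §1 `L³` sizes -/

/-- `tinyProfileAt R a = (Y₀(R)/Y₀(wide)) • tinyProfile a`. [folklore] -/
theorem tinyProfileAt_eq_smul (R : TowerRates) (a : ℝ) :
    tinyProfileAt R a = (R.Y 0 / TowerRates.wide.Y 0) • tinyProfile a := by
  funext y
  show R.Y 0 • tinyBlob a y = (R.Y 0 / TowerRates.wide.Y 0) • (TowerRates.wide.Y 0 • tinyBlob a y)
  rw [smul_smul, div_mul_cancel₀ _ Host.wide_Y_zero_pos.ne']

/-- `‖tinyProfileAt R a‖₃ = (Y₀(R)/Y₀(wide)) ‖tinyProfile a‖₃`. [folklore] -/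
theorem eLpNorm_tinyProfileAt (R : TowerRates) (a : ℝ) :
    eLpNorm (tinyProfileAt R a) 3 volume =
      ENNReal.ofReal (R.Y 0 / TowerRates.wide.Y 0) * eLpNorm (tinyProfile a) 3 volume := by
  rw [tinyProfileAt_eq_smul, eLpNorm_const_smul, Real.enorm_eq_ofReal_abs,
    abs_of_pos (div_pos (R.Y_pos 0) Host.wide_Y_zero_pos)]

/-- **The blob at `R` is `L³`-small**: `‖tinyProfileAt R a‖₃ ≤ δ` once `a ≤ 1` and
`8 a (|B̄₁| + 1) Y₀(wide)³ ≤ (δ Y₀(wide)/Y₀(R))³`. [folklore] -/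
theorem eLpNorm_tinyProfileAt_le_of_small (ha : 0 < a) (ha1 : a ≤ 1) {δ : ℝ} (hδ : 0 < δ)
    (hsmall : 8 * a * (unitBallVol + 1) * TowerRates.wide.Y 0 ^ 3 ≤ (δ * TowerRates.wide.Y 0 / R.Y 0) ^ 3) :
    eLpNorm (tinyProfileAt R a) 3 volume ≤ ENNReal.ofReal δ := by
  have hq : 0 < R.Y 0 / TowerRates.wide.Y 0 := div_pos (R.Y_pos 0) Host.wide_Y_zero_pos
  have hδ' : 0 < δ * TowerRates.wide.Y 0 / R.Y 0 := by
    have := R.Y_pos 0; have := Host.wide_Y_zero_pos; positivity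
  have h := eLpNorm_tinyProfile_le_of_small ha ha1 hδ' hsmall
  rw [eLpNorm_tinyProfileAt]
  have hY1 : R.Y 0 ≠ 0 := (R.Y_pos 0).ne'
  have hY2 : TowerRates.wide.Y 0 ≠ 0 := Host.wide_Y_zero_pos.ne'
  calc ENNReal.ofReal (R.Y 0 / TowerRates.wide.Y 0) * eLpNorm (tinyProfile a) 3 volume
      ≤ ENNReal.ofReal (R.Y 0 / TowerRates.wide.Y 0) * ENNReal.ofReal (δ * TowerRates.wide.Y 0 / R.Y 0) := by
        gcongr
    _ = ENNReal.ofReal δ := by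
        rw [← ENNReal.ofReal_mul hq.le]
        congr 1
        field_simp

/-- **`‖U‖₃ ≤ ‖tinyProfileAt R a‖₃ + ‖faintPusher μ‖₃`** for the tame carrier at `R`. [folklore] -/
theorem eLpNorm_tameCarrierAt_le (R : TowerRates) (a lam : ℝ) :
    eLpNorm (tameCarrierAt R a lam) 3 volume ≤
      eLpNorm (tinyProfileAt R a) 3 volume +
        eLpNorm (faintPusher (lam * (R.Y 0 / TowerRates.wide.Y 0))) 3 volume := by
  rw [tameCarrierAt]
  exact eLpNorm_add_le (contDiff_tinyProfileAt R a).continuous.aestronglyMeasurable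
    (contDiff_faintPusher _).continuous.aestronglyMeasurable (by norm_num)

/-! ## §2 Strict-slot fillers at `R` of arbitrarily small `L³` size -/

/-- **TAME CARRIERS OF ARBITRARILY SMALL `L³` SIZE FILL THE STRICT SLOT AT `R`**: for every `δ > 0` there are
admissible `a` and `λ ∈ (0, 1]` with `LevelZeroDataAt R (tameCarrierAt R a λ) 7` and
`‖tameCarrierAt R a λ‖_{L³} ≤ δ`. [cite: Palasek2026ElementaryModel, §3.3] [cite: Kato1984, Thm. 2] -/
theorem exists_levelZeroDataAt_eLpNorm_le (R : TowerRates) {δ : ℝ} (hδ : 0 < δ) :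
    ∃ a lam : ℝ, 0 < a ∧ 0 < lam ∧ lam ≤ 1 ∧
      LevelZeroDataAt R (tameCarrierAt R a lam) 7 ∧
      eLpNorm (tameCarrierAt R a lam) 3 volume ≤ ENNReal.ofReal δ := by
  have hYw := Host.wide_Y_zero_pos
  have hYR := R.Y_pos 0
  have hN := R.N_pos 0
  have hv := unitBallVol_nonneg
  have hκ := strainConst_pos
  -- the blob scale
  set D : ℝ := 8 * (unitBallVol + 1) * TowerRates.wide.Y 0 ^ 3 with hD
  have hDpos : 0 < D := by positivity
  set δ' : ℝ := δ / 2 * TowerRates.wide.Y 0 / R.Y 0 with hδ'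
  have hδ'pos : 0 < δ' := by positivity
  set a : ℝ := min (min (5 / 256) (5 / R.N 0)) (min (strainConst / R.N 0) (δ' ^ 3 / D)) with ha
  have ha0 : 0 < a := lt_min (lt_min (by norm_num) (by positivity)) (lt_min (by positivity) (by positivity))
  have h5 : a ≤ 5 / 256 := (min_le_left _ _).trans (min_le_left _ _)
  have h5N : a ≤ 5 / R.N 0 := (min_le_left _ _).trans (min_le_right _ _)
  have hκN : a ≤ strainConst / R.N 0 := (min_le_right _ _).trans (min_le_left _ _)
  have haD : a ≤ δ' ^ 3 / D := (min_le_right _ _).trans (min_le_right _ _)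
  have ha1 : a ≤ 1 := h5.trans (by norm_num)
  have hsmall : 8 * a * (unitBallVol + 1) * TowerRates.wide.Y 0 ^ 3 ≤
      (δ / 2 * TowerRates.wide.Y 0 / R.Y 0) ^ 3 := by
    rw [le_div_iff₀ hDpos] at haD
    calc 8 * a * (unitBallVol + 1) * TowerRates.wide.Y 0 ^ 3 = a * D := by rw [hD]; ring
      _ ≤ δ' ^ 3 := haD
  have hblob := eLpNorm_tinyProfileAt_le_of_small (R := R) ha0 ha1 (half_pos hδ) hsmall
  -- the pusher scale
  set P : ℝ := (eLpNorm farPusher 3 volume).toReal with hP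
  have hP0 : 0 ≤ P := ENNReal.toReal_nonneg
  set lam : ℝ := min 1 ((δ / 2) / ((P + 1) * (R.Y 0 / TowerRates.wide.Y 0))) with hlam
  have hq : 0 < R.Y 0 / TowerRates.wide.Y 0 := div_pos hYR hYw
  have hlam0 : 0 < lam := lt_min one_pos (by positivity)
  have hlam1 : lam ≤ 1 := min_le_left _ _
  have hpush : eLpNorm (faintPusher (lam * (R.Y 0 / TowerRates.wide.Y 0))) 3 volume ≤ ENNReal.ofReal (δ / 2) := by
    refine eLpNorm_faintPusher_le (by positivity) ?_
    have h1 : lam ≤ (δ / 2) / ((P + 1) * (R.Y 0 / TowerRates.wide.Y 0)) := min_le_right _ _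
    rw [le_div_iff₀ (by positivity)] at h1
    calc lam * (R.Y 0 / TowerRates.wide.Y 0) * (P + 1) = lam * ((P + 1) * (R.Y 0 / TowerRates.wide.Y 0)) := by
          ring
      _ ≤ δ / 2 := h1
  refine ⟨a, lam, ha0, hlam0, hlam1, levelZeroDataAt_tameCarrierAt ha0 h5 h5N hκN hlam0 hlam1, ?_⟩
  calc eLpNorm (tameCarrierAt R a lam) 3 volume
      ≤ eLpNorm (tinyProfileAt R a) 3 volume +
          eLpNorm (faintPusher (lam * (R.Y 0 / TowerRates.wide.Y 0))) 3 volume := eLpNorm_tameCarrierAt_le R a lam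
    _ ≤ ENNReal.ofReal (δ / 2) + ENNReal.ofReal (δ / 2) := add_le_add hblob hpush
    _ = ENNReal.ofReal δ := by rw [← ENNReal.ofReal_add (by positivity) (by positivity)]; ring_nf

/-- The same with the hypotheses a free-run theorem consumes spelled out. [cite: Palasek2026ElementaryModel, §3.3] -/
theorem exists_levelZeroDataAt_small (R : TowerRates) (δ : ℝ) (hδ : 0 < δ) :
    ∃ U : EuclideanSpace ℝ (Fin 3) → EuclideanSpace ℝ (Fin 3),
      LevelZeroDataAt R U 7 ∧ ContDiff ℝ ∞ U ∧ HasCompactSupport U ∧ VectorCalculus.IsDivFree U ∧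
      (∀ x, ‖U x‖ ≤ R.Y 0) ∧ (eLpNorm U 3 volume).toReal ≤ δ := by
  obtain ⟨a, lam, -, -, -, hLZ, hL3⟩ := exists_levelZeroDataAt_eLpNorm_le R hδ
  refine ⟨tameCarrierAt R a lam, hLZ, hLZ.smooth, hLZ.confined.2, hLZ.divFree, hLZ.ceiling, ?_⟩
  have hlt : eLpNorm (tameCarrierAt R a lam) 3 volume < ⊤ := hL3.trans_lt ENNReal.ofReal_lt_top
  have := (ENNReal.toReal_le_toReal hlt.ne ENNReal.ofReal_ne_top).2 hL3
  rwa [ENNReal.toReal_ofReal hδ.le] at this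

/-! ## §3 The tame carrier run at `R` -/

/-- **THE TAME CARRIER RUN AT THE RATES `R`.** There is a strict-slot carrier `U` at `R`
(`LevelZeroDataAt R U 7`) with a classical finite-energy FREE Navier–Stokes run `(v, q)` at unit viscosity
on `[1, τ₁(R)]` from `v 1 = U` obeying `‖v t x‖ ≤ 2 Y₀(R)` throughout (Kato small data for long times, Leray
short time for short times: `exists_classical_run_norm_le_two_mul_Icc`).
[cite: Kato1984, Thm. 2–4] [cite: Leray1934, §19 (3.8) p. 223 and §21 (3.15) p. 226] -/
theorem exists_levelZeroDataAt_tame_freeRun (R : TowerRates) :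
    ∃ U : EuclideanSpace ℝ (Fin 3) → EuclideanSpace ℝ (Fin 3), LevelZeroDataAt R U 7 ∧
      ∃ (v : ℝ → EuclideanSpace ℝ (Fin 3) → EuclideanSpace ℝ (Fin 3))
        (q : ℝ → EuclideanSpace ℝ (Fin 3) → ℝ),
        IsClassicalNSSolutionOn (Icc 1 (Host.τfirstAt R)) 1 0 v q ∧ v 1 = U ∧
        (∃ C : ℝ≥0∞, C < ⊤ ∧ ∀ t ∈ Icc (1 : ℝ) (Host.τfirstAt R), ∫⁻ x, ‖v t x‖ₑ ^ 2 ≤ C) ∧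
        ∀ t ∈ Icc (1 : ℝ) (Host.τfirstAt R), ∀ x, ‖v t x‖ ≤ 2 * R.Y 0 := by
  obtain ⟨c, hc, hrun⟩ := exists_classical_run_norm_le_two_mul_Icc
  obtain ⟨U, hLZ, hsm, hcs, hdiv, hceil, hL3⟩ := exists_levelZeroDataAt_small R (c * 1) (by rwa [mul_one])
  obtain ⟨v, q, hv, hv1, hE, hbd⟩ :=
    hrun one_pos (Host.one_lt_τfirstAt R) hsm hcs hdiv (R.Y_pos 0) hceil hL3
  exact ⟨U, hLZ, v, q, hv, hv1, hE, hbd⟩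

/-- **THE TAME CARRIER RUN AT `R` UNDER THE DOOR'S CAP.** If the rates afford the registered band
`2Y₀ ≤ Y₁`, then for every margin `η ≤ Y₁(R)/3` there is a strict-slot carrier at `R` with a classical
finite-energy free run on `[1, τ₁(R)]` staying below `(5/3) Y₁(R) − η`. [cite: Kato1984, Thm. 2–4]
[cite: Palasek2026ElementaryModel, §3.3] -/
theorem exists_levelZeroDataAt_tame_freeRun_cap (hsep : 2 * R.Y 0 ≤ R.Y 1) {η : ℝ} (hη : η ≤ R.Y 1 / 3) :
    ∃ U : EuclideanSpace ℝ (Fin 3) → EuclideanSpace ℝ (Fin 3), LevelZeroDataAt R U 7 ∧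
      ∃ (v : ℝ → EuclideanSpace ℝ (Fin 3) → EuclideanSpace ℝ (Fin 3))
        (q : ℝ → EuclideanSpace ℝ (Fin 3) → ℝ),
        IsClassicalNSSolutionOn (Icc 1 (Host.τfirstAt R)) 1 0 v q ∧ v 1 = U ∧
        (∃ C : ℝ≥0∞, C < ⊤ ∧ ∀ t ∈ Icc (1 : ℝ) (Host.τfirstAt R), ∫⁻ x, ‖v t x‖ₑ ^ 2 ≤ C) ∧
        ∀ t ∈ Icc (1 : ℝ) (Host.τfirstAt R), ∀ x, ‖v t x‖ ≤ 5 / 3 * R.Y 1 - η := by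
  obtain ⟨U, hLZ, v, q, hv, hv1, hE, hbd⟩ := exists_levelZeroDataAt_tame_freeRun R
  have hY := R.Y_pos 0
  have hcap : 2 * R.Y 0 ≤ 5 / 3 * R.Y 1 - η := by linarith
  exact ⟨U, hLZ, v, q, hv, hv1, hE, fun t ht x => (hbd t ht x).trans hcap⟩

/-! ## §4 At the tuned rates -/

/-- **The tame carrier run at `TowerRates.tuned`** under the cap `(5/3) Y₁ − η`, every `η ≤ Y₁/3`
(`tuned_sep`). [cite: Kato1984, Thm. 2–4] [cite: Palasek2026ElementaryModel, §3.3] -/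
theorem tuned_exists_levelZeroDataAt_tame_freeRun_cap {η : ℝ} (hη : η ≤ TowerRates.tuned.Y 1 / 3) :
    ∃ U : EuclideanSpace ℝ (Fin 3) → EuclideanSpace ℝ (Fin 3), LevelZeroDataAt TowerRates.tuned U 7 ∧
      ∃ (v : ℝ → EuclideanSpace ℝ (Fin 3) → EuclideanSpace ℝ (Fin 3))
        (q : ℝ → EuclideanSpace ℝ (Fin 3) → ℝ),
        IsClassicalNSSolutionOn (Icc 1 (Host.τfirstAt TowerRates.tuned)) 1 0 v q ∧ v 1 = U ∧
        (∃ C : ℝ≥0∞, C < ⊤ ∧ ∀ t ∈ Icc (1 : ℝ) (Host.τfirstAt TowerRates.tuned), ∫⁻ x, ‖v t x‖ₑ ^ 2 ≤ C) ∧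
        ∀ t ∈ Icc (1 : ℝ) (Host.τfirstAt TowerRates.tuned), ∀ x, ‖v t x‖ ≤ 5 / 3 * TowerRates.tuned.Y 1 - η :=
  exists_levelZeroDataAt_tame_freeRun_cap (by simpa using TowerRates.tuned_sep 0) hη

end Summit.NavierStokesRegularity.FluidComputer.PalasekTowerClayBridge.Germ

end
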